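import Literature.NumberTheory.LFunctions.ChebyshevHalfLineBiasThm9Proofs
import Literature.NumberTheory.LFunctions.ChebyshevHalfLineBiasThm4Proofs
import Mathlib.Analysis.Asymptotics.AsymptoticEquivalent
import HarnessLib

/-!
# GRH(χ₄)-EQUIVALENT criterion, asymptotic form (Suzuki 2025, §1.2, the sentence after Thm 4), PROVED — «nothing here bears on the truth of RH»
# `GRH for L(s, χ₄)` ⟺ `Σ_{2<p≤x} (−1)^{(p−1)/2} log p · √(x/p) log(x/p) ∼ −(√x/4)(log x)²`

LINE 1 — LABEL: RH-FREE literature (a kernel proof of a GRH(χ₄)-EQUIVALENCE; the asymptotic itself is GRH(χ₄)-CONDITIONAL).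
An equivalence fixes WHICH asymptotic statement IS the GRH for `L(s, χ₄)`; it is not a route and not progress toward RH or
GRH; nothing here bears on the truth of RH. TRIAGE-TYPING tranche 1 part 2 (director-rh 2026-08-26, D-0088(4)): a cheap
kernel consequence of the tree's discharged facts; theorems only — no definition, no named fact (D-0014/D-0026).

M. Suzuki, *On variants of Chebyshev's conjecture*, Ramanujan J. **68** (2025), no. 4, art. 95 = arXiv:2411.07436
[`Suzuki2025Chebyshev`; PUBLISHED, refereed], §1.2, the paragraph after **Theorem 4**, AS PRINTED (journal p. 8): «According
to the proof of Theorem 4, GRH for `L(s, χ₄)` is equivalent to the left-hand side of (1.18) being asymptotically equal to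
`−(√x/4)(log x)²`; thus, unlike (1.19), it does not yield a result stronger than GRH.» ((1.18) is the sum
`Σ_{2<p≤x} (−1)^{(p−1)/2} log p · √(x/p) log(x/p)` of Thm 4; (1.19) is the Aoki–Koyama asymptotic, a statement of other
papers, NOT typed.) The sentence was quoted in the docstring of the named fact `Suzuki2025Chebyshev_thm4`
(`ChebyshevHalfLineBiasVariants.lean`) but not stated; it is stated and PROVED here, with «asymptotically equal» read as
Mathlib's `Asymptotics.IsEquivalent` (`u ~[atTop] v` ⟺ `u − v = o(v)`):

* `Suzuki2025Chebyshev_thm4_isEquivalent_of_GRH` — GRH(χ₄) ⟹ (1.18) `∼ −(√x/4) log²x`: the tree's discharged Thm 9 (4.8)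
  `SuzukiThm9.Suzuki2025Chebyshev_thm9_asymp_holds` (`ChebyshevHalfLineBiasThm9Proofs.lean`: `Σ_{p≤x} χ(p) log p √(x/p) log(x/p) +
  (√x/4) log²x = O(√x log x)` for real non-principal `χ` under GRH and `L(½, χ) ≠ 0`) at `χ = χ₄` (primitive, `L(½, χ₄) ≠ 0`:
  the tree's `SuzukiChi4Riesz.χ4_isPrimitive`, `SuzukiChi4Riesz.LFunction_χ4_half_ne_zero`), the identification of the two
  prime sums (`SuzukiChi4Asymptotic.primeSum_chi4_eq`: `χ₄(2) = 0`, `χ₄(p) = (−1)^{(p−1)/2}` for odd `p`), and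
  `√x log x = o(√x log²x)`;
* `Suzuki2025Chebyshev_GRH_of_thm4_isEquivalent` — (1.18) `∼ −(√x/4) log²x` ⟹ (1.18) `→ −∞` ⟹ GRH(χ₄), by the tree's
  `Suzuki2025Chebyshev_thm4_mpr` (`ChebyshevHalfLineBiasChi4Proofs.lean`);
* `Suzuki2025Chebyshev_thm4_asymptotic_iff` — the printed equivalence.

## References
* [Suzuki2025Chebyshev] M. Suzuki, Ramanujan J. 68 (2025) 95 = arXiv:2411.07436: §1.2 Thm 4, (1.18), and the paragraph
  after it; §4.2 Thm 9, (4.8).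
-/

noncomputable section

open Filter Topology Asymptotics
open scoped Real

namespace Literature.NumberTheory.LFunctions

namespace SuzukiChi4Asymptotic

/-- `χ₄(n)` as a complex number is the integer `χ₄(n)`. [folklore] -/
private theorem chi_apply (n : ℕ) :
    (ZMod.χ₄.ringHomComp (Int.castRingHom ℂ)) (n : ZMod 4) = ((ZMod.χ₄ (n : ZMod 4) : ℤ) : ℂ) := by
  rw [MulChar.ringHomComp_apply]
  simp

/-- `χ₄` is real-valued. [folklore] -/
private theorem chi_real (a : ZMod 4) : ((ZMod.χ₄.ringHomComp (Int.castRingHom ℂ)) a).im = 0 := by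
  rw [MulChar.ringHomComp_apply]
  simp

/-- `χ₄ ≠ χ₀` (its conductor is `4`, the tree's `SuzukiChi4Riesz.χ4_isPrimitive`). [folklore] -/
private theorem chi_ne_one : (ZMod.χ₄.ringHomComp (Int.castRingHom ℂ) : DirichletCharacter ℂ 4) ≠ 1 := by
  intro h
  have hc := SuzukiChi4Riesz.χ4_isPrimitive
  rw [DirichletCharacter.isPrimitive_def, h, DirichletCharacter.conductor_one] at hc
  norm_num at hc

/-- **The two typed prime sums agree**: the Thm 9 sum `Σ_{p ≤ x} Re χ₄(p) log p √(x/p) log(x/p)` (over all primes `p ≤ x`)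
equals the Thm 4 sum (1.18) `Σ_{2 < p ≤ x} (−1)^{(p−1)/2} log p √(x/p) log(x/p)` — `χ₄(2) = 0` and `χ₄(p) = (−1)^{(p−1)/2}`
for odd `p`. [cite: Suzuki2025Chebyshev, §1.2 Thm 4 as Thm 9 at χ = χ₄] -/
theorem primeSum_chi4_eq (x : ℝ) :
    ∑ p ∈ (Finset.Icc 1 ⌊x⌋₊).filter Nat.Prime,
        ((ZMod.χ₄.ringHomComp (Int.castRingHom ℂ)) (p : ZMod 4)).re * Real.log p * Real.sqrt (x / p) *
          Real.log (x / p) =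
      ∑ p ∈ (Finset.Ioc 2 ⌊x⌋₊).filter Nat.Prime,
        (-1 : ℝ) ^ ((p - 1) / 2) * Real.log p * Real.sqrt (x / p) * Real.log (x / p) := by
  have hsub : (Finset.Ioc 2 ⌊x⌋₊).filter Nat.Prime ⊆ (Finset.Icc 1 ⌊x⌋₊).filter Nat.Prime := by
    intro p hp
    simp only [Finset.mem_filter, Finset.mem_Ioc, Finset.mem_Icc] at hp ⊢
    exact ⟨⟨by omega, hp.1.2⟩, hp.2⟩
  have hvan : ∀ p ∈ (Finset.Icc 1 ⌊x⌋₊).filter Nat.Prime, p ∉ (Finset.Ioc 2 ⌊x⌋₊).filter Nat.Prime →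
      ((ZMod.χ₄.ringHomComp (Int.castRingHom ℂ)) (p : ZMod 4)).re * Real.log p * Real.sqrt (x / p) *
        Real.log (x / p) = 0 := by
    intro p hp hp'
    rw [Finset.mem_filter, Finset.mem_Icc] at hp
    have hp2 : p = 2 := by
      by_contra hne
      have h2 := hp.2.two_le
      exact hp' (Finset.mem_filter.2 ⟨Finset.mem_Ioc.2 ⟨by omega, hp.1.2⟩, hp.2⟩)
    subst hp2
    have h0 : ZMod.χ₄ ((2 : ℕ) : ZMod 4) = 0 := by decide
    rw [chi_apply, h0]
    simp
  rw [← Finset.sum_subset hsub hvan]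
  refine Finset.sum_congr rfl fun p hp ↦ ?_
  rw [Finset.mem_filter, Finset.mem_Ioc] at hp
  have hodd : p % 2 = 1 := by
    rcases hp.2.eq_two_or_odd' with h2 | ho
    · omega
    · exact Nat.odd_iff.1 ho
  have hre : ((ZMod.χ₄.ringHomComp (Int.castRingHom ℂ)) (p : ZMod 4)).re = (-1 : ℝ) ^ ((p - 1) / 2) := by
    rw [chi_apply, Complex.intCast_re, ZMod.χ₄_eq_neg_one_pow hodd, show (p - 1) / 2 = p / 2 by omega]
    push_cast
    ring
  rw [hre]

/-- `√x log x = o(√x log²x / 4)` at `+∞`. [folklore] -/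
private theorem isLittleO_sqrt_mul_log :
    (fun x : ℝ ↦ Real.sqrt x * Real.log x) =o[atTop] fun x : ℝ ↦ -(Real.sqrt x / 4 * Real.log x ^ 2) := by
  refine Asymptotics.isLittleO_neg_right.2 ?_
  have h2 : (fun _ : ℝ ↦ (1 : ℝ)) =o[atTop] fun x : ℝ ↦ Real.log x / 4 := by
    rw [Asymptotics.isLittleO_const_left]
    right
    have h : Tendsto (fun x : ℝ ↦ Real.log x / 4) atTop atTop :=
      Real.tendsto_log_atTop.atTop_div_const (by norm_num)
    exact tendsto_norm_atTop_atTop.comp h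
  have h3 := (Asymptotics.isBigO_refl (fun x : ℝ ↦ Real.sqrt x * Real.log x) atTop).mul_isLittleO h2
  refine (h3.congr_left fun x ↦ ?_).congr_right fun x ↦ ?_
  · ring
  · ring

/-- `−(√x/4) log²x → −∞`. [folklore] -/
private theorem tendsto_model_atBot :
    Tendsto (fun x : ℝ ↦ -(Real.sqrt x / 4 * Real.log x ^ 2)) atTop atBot := by
  have hv' : Tendsto (fun x : ℝ ↦ Real.sqrt x / 4 * Real.log x ^ 2) atTop atTop := by
    refine tendsto_atTop_mono' atTop ?_ Real.tendsto_log_atTop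
    filter_upwards [eventually_ge_atTop (16 : ℝ), Real.tendsto_log_atTop.eventually_ge_atTop 1] with x hx hlx
    have hsx : 4 ≤ Real.sqrt x := by
      rw [show (4 : ℝ) = Real.sqrt 16 by
        rw [show (16 : ℝ) = 4 ^ 2 by norm_num, Real.sqrt_sq (by norm_num : (0 : ℝ) ≤ 4)]]
      exact Real.sqrt_le_sqrt hx
    nlinarith
  exact tendsto_neg_atTop_atBot.comp hv'

end SuzukiChi4Asymptotic

open SuzukiChi4Asymptotic in
/-- **GRH(χ₄) ⟹ (1.18) is asymptotically `−(√x/4)(log x)²`** («only if» half of the printed sentence): from the tree's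
Thm 9 (4.8) at `χ = χ₄` (`SuzukiThm9.Suzuki2025Chebyshev_thm9_asymp_holds`, error `O(√x log x) = o(√x log²x)`).
GRH(χ₄)-CONDITIONAL asymptotic. [cite: Suzuki2025Chebyshev, §1.2, paragraph after Thm 4 («equivalent to the left-hand side of (1.18) being asymptotically equal to −(√x/4)(log x)²»)] -/
theorem Suzuki2025Chebyshev_thm4_isEquivalent_of_GRH
    (hGRH : DirichletCharacter.RiemannHypothesis (ZMod.χ₄.ringHomComp (Int.castRingHom ℂ) : DirichletCharacter ℂ 4)) :
    (fun x : ℝ ↦ ∑ p ∈ (Finset.Ioc 2 ⌊x⌋₊).filter Nat.Prime,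
        (-1 : ℝ) ^ ((p - 1) / 2) * Real.log p * Real.sqrt (x / p) * Real.log (x / p)) ~[atTop]
      fun x : ℝ ↦ -(Real.sqrt x / 4 * Real.log x ^ 2) := by
  set χ : DirichletCharacter ℂ 4 := ZMod.χ₄.ringHomComp (Int.castRingHom ℂ) with hχ
  have h9 := SuzukiThm9.Suzuki2025Chebyshev_thm9_asymp_holds 4 χ chi_ne_one chi_real hGRH
    SuzukiChi4Riesz.LFunction_χ4_half_ne_zero
  refine Asymptotics.IsLittleO.isEquivalent ?_
  have h5 : ((fun x : ℝ ↦ ∑ p ∈ (Finset.Ioc 2 ⌊x⌋₊).filter Nat.Prime,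
        (-1 : ℝ) ^ ((p - 1) / 2) * Real.log p * Real.sqrt (x / p) * Real.log (x / p)) -
        fun x : ℝ ↦ -(Real.sqrt x / 4 * Real.log x ^ 2)) =
      fun x : ℝ ↦ ∑ p ∈ (Finset.Icc 1 ⌊x⌋₊).filter Nat.Prime,
          (χ (p : ZMod 4)).re * Real.log p * Real.sqrt (x / p) * Real.log (x / p)
        + Real.sqrt x / 4 * Real.log x ^ 2 := by
    funext x
    simp only [Pi.sub_apply]
    rw [hχ, primeSum_chi4_eq x]
    ring
  rw [h5]
  exact h9.trans_isLittleO isLittleO_sqrt_mul_log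

open SuzukiChi4Asymptotic in
/-- **(1.18) asymptotically `−(√x/4)(log x)²` ⟹ GRH(χ₄)** («if» half of the printed sentence): the asymptotic forces
(1.18) `→ −∞`, and Thm 4 («if», the tree's `Suzuki2025Chebyshev_thm4_mpr`) gives GRH for `L(s, χ₄)`.
[cite: Suzuki2025Chebyshev, §1.2, paragraph after Thm 4 (with Thm 4)] -/
theorem Suzuki2025Chebyshev_GRH_of_thm4_isEquivalent
    (h : (fun x : ℝ ↦ ∑ p ∈ (Finset.Ioc 2 ⌊x⌋₊).filter Nat.Prime,
        (-1 : ℝ) ^ ((p - 1) / 2) * Real.log p * Real.sqrt (x / p) * Real.log (x / p)) ~[atTop]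
      fun x : ℝ ↦ -(Real.sqrt x / 4 * Real.log x ^ 2)) :
    DirichletCharacter.RiemannHypothesis (ZMod.χ₄.ringHomComp (Int.castRingHom ℂ) : DirichletCharacter ℂ 4) :=
  Suzuki2025Chebyshev_thm4_mpr (h.tendsto_atBot_iff.2 tendsto_model_atBot)

/-- **Suzuki 2025, the sentence after Theorem 4, PROVED**: «GRH for `L(s, χ₄)` is equivalent to the left-hand side of (1.18)
being asymptotically equal to `−(√x/4)(log x)²`.» GRH(χ₄)-EQUIVALENT criterion (an equivalence; nothing here bears on the
truth of RH or GRH). [cite: Suzuki2025Chebyshev, §1.2, paragraph after Thm 4] -/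
theorem Suzuki2025Chebyshev_thm4_asymptotic_iff :
    DirichletCharacter.RiemannHypothesis (ZMod.χ₄.ringHomComp (Int.castRingHom ℂ) : DirichletCharacter ℂ 4) ↔
      (fun x : ℝ ↦ ∑ p ∈ (Finset.Ioc 2 ⌊x⌋₊).filter Nat.Prime,
          (-1 : ℝ) ^ ((p - 1) / 2) * Real.log p * Real.sqrt (x / p) * Real.log (x / p)) ~[atTop]
        fun x : ℝ ↦ -(Real.sqrt x / 4 * Real.log x ^ 2) :=
  ⟨Suzuki2025Chebyshev_thm4_isEquivalent_of_GRH, Suzuki2025Chebyshev_GRH_of_thm4_isEquivalent⟩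

end Literature.NumberTheory.LFunctions
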